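import Summits.Ventures.PercRepro.SMC
import Summits.Ventures.PercRepro.SwapSets

/-!
# Gladkov–Zimin's inequality (final) by the static decision-tree swap

`P(a≁b ∧ a≁c) · P(a~b ∨ a~c) ≤ P(ab|c) + P(ac|b) + P(bc|a)` (Gladkov–Zimin, *Bond percolation
does not simulate site percolation*, arXiv:2404.08873, Theorem 4.6, eq. (final)) — the cell's
first decision-tree theorem, proved without decision trees: only the static swap lemma
(`SwapBijection.lean`) and the three recoverable edge sets `S₁, S₂, S₃` (`SwapSets.lean`).

Proof.  The swap along `S₃ = edgesAt (B ∪ C) \ edgesAt A` gives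
`P(a≁b ∧ a≁c) · P(a~b ∨ a~c) = ∑_{ω,ω'} w(ω) w(ω') 1[ω →_{S₃ᶜ} ω' ∈ a|b ∩ a|c] 1[ω →_{S₃} ω' ∈ ab ∪ ac]`
and `ω →_{S₃ᶜ} ω'` has the `a`-cluster of `ω` (`mem_sep_mix_compl_swapSetBC_iff`).  The paper's
key observation (`conn_swapSetC_of_conn_swapSetBC`): if `ω ∈ a|b|c` and `a` is joined to `b` or
`c` in `ω →_{S₃} ω'`, the path first enters `B ∪ C` through an edge leaving `A` (every other edge
into `B ∪ C` carries `ω` and is closed), so `ω →_{S₁} ω' ∈ ab|c` or `ω →_{S₂} ω' ∈ ac|b` — and the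
swaps along `S₁`, `S₂` are measure preserving, which bounds this part by `P(ab|c) + P(ac|b)`;
the part `ω ∈ a|bc` is bounded by `P(bc|a)` (`indicator_bound`, `gz24_final_events`).

Main results: `MultiGraph.gz24_final_events` (event form, no distinctness needed),
`MultiGraph.gz24_final_law3` (the engine's rows: `(B + P3)(T + P1 + P2) ≤ P1 + P2 + P3`) and the
corollary `MultiGraph.c021_const_one` / `c021_const_one_law3` (`T · B ≤ P1 + P2 + P3`, the constant-1
form of the cell's C-021, p2's LIT record);
`GZ24Final_holds : GZ24Final` (typer-2's named statement) is in
`Summits.Ventures.PercRepro.GZ24Benchmark`.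
-/

namespace PercRepro

open Finset

namespace MultiGraph

variable {V E : Type*} {G : MultiGraph V E}

/-! ### The key observation: a path from `a` in `ω →_{S₃} ω'` enters `B ∪ C` from `A` -/

section KeyObservation

variable {ω ω' : Config E} {a b c : V}

/-- Membership in the `a`-cluster is connectivity from `a`. -/
theorem mem_cluster_iff_conn {x : V} : x ∈ G.cluster ω a ↔ G.Conn ω a x := Iff.rfl

/-- An edge of `ω →_{S₃} ω'` open between two vertices outside `B ∪ C` is open in
`ω →_{S₁} ω'` (both carry `ω'` there). -/
theorem swapSetC_open_of_outside {x y : V} {e : E}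
    (hxB : x ∉ G.cluster ω b) (hxC : x ∉ G.cluster ω c)
    (hyB : y ∉ G.cluster ω b) (hyC : y ∉ G.cluster ω c)
    (he : mix (G.swapSetBC ω a b c) ω ω' e = true)
    (hend : (G.fst e = x ∧ G.snd e = y) ∨ (G.fst e = y ∧ G.snd e = x)) :
    mix (G.swapSetC ω a b c) ω ω' e = true := by
  have hB : e ∉ G.edgesAt (G.cluster ω b) := by
    rintro (h | h) <;> rcases hend with ⟨h1, h2⟩ | ⟨h1, h2⟩
    · exact hxB (h1 ▸ h)
    · exact hyB (h1 ▸ h)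
    · exact hyB (h2 ▸ h)
    · exact hxB (h2 ▸ h)
  have hC : e ∉ G.edgesAt (G.cluster ω c) := by
    rintro (h | h) <;> rcases hend with ⟨h1, h2⟩ | ⟨h1, h2⟩
    · exact hxC (h1 ▸ h)
    · exact hyC (h1 ▸ h)
    · exact hyC (h2 ▸ h)
    · exact hxC (h2 ▸ h)
  have h3 : e ∉ G.swapSetBC ω a b c := by
    intro hmem
    rcases (G.mem_swapSetBC.mp hmem).1 with h | h
    · exact hB h
    · exact hC h
  have h1 : e ∉ G.swapSetC ω a b c := by
    intro hmem
    rcases G.mem_swapSetC.mp hmem with h | h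
    · exact hC h
    · exact hB h.1
  rw [mix_apply_of_notMem h3] at he
  rw [mix_apply_of_notMem h1]
  exact he

/-- An edge of `ω →_{S₃} ω'` open from a vertex outside `B ∪ C` into `B` leaves `A`, and is open
in `ω →_{S₁} ω'` (it lies off `S₁` and off `S₃`, so both carry `ω'`). -/
theorem swapSetC_open_of_into {x y : V} {e : E}
    (hab : ¬ G.Conn ω a b) (hbc : ¬ G.Conn ω b c)
    (hxB : x ∉ G.cluster ω b) (hxC : x ∉ G.cluster ω c) (hy : y ∈ G.cluster ω b)
    (he : mix (G.swapSetBC ω a b c) ω ω' e = true)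
    (hend : (G.fst e = x ∧ G.snd e = y) ∨ (G.fst e = y ∧ G.snd e = x)) :
    mix (G.swapSetC ω a b c) ω ω' e = true := by
  have hyA : y ∉ G.cluster ω a := fun h => hab ((h : G.Conn ω a y).trans (hy : G.Conn ω b y).symm)
  have hyC : y ∉ G.cluster ω c := fun h => hbc ((hy : G.Conn ω b y).trans (h : G.Conn ω c y).symm)
  have heB : e ∈ G.edgesAt (G.cluster ω b) := by
    rcases hend with ⟨h1, h2⟩ | ⟨h1, h2⟩
    · exact Or.inr (h2 ▸ hy)
    · exact Or.inl (h1 ▸ hy)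
  -- `x ∈ A`: otherwise `e ∈ S₃` carries `ω`, and an `ω`-open edge at `B` would put `x` in `B`
  have hxA : x ∈ G.cluster ω a := by
    by_contra hxA
    have heA : e ∉ G.edgesAt (G.cluster ω a) := by
      rintro (h | h) <;> rcases hend with ⟨h1, h2⟩ | ⟨h1, h2⟩
      · exact hxA (h1 ▸ h)
      · exact hyA (h1 ▸ h)
      · exact hyA (h2 ▸ h)
      · exact hxA (h2 ▸ h)
    have h3 : e ∈ G.swapSetBC ω a b c := G.mem_swapSetBC.mpr ⟨Or.inl heB, heA⟩
    rw [mix_apply_of_mem h3] at he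
    apply hxB
    rcases hend with ⟨h1, h2⟩ | ⟨h1, h2⟩
    · exact h1 ▸ G.fst_mem_cluster_of_open he (h2 ▸ hy)
    · exact h2 ▸ G.snd_mem_cluster_of_open he (h1 ▸ hy)
  have hxC' : x ∉ G.cluster ω c := hxC
  have heA : e ∈ G.edgesAt (G.cluster ω a) := by
    rcases hend with ⟨h1, h2⟩ | ⟨h1, h2⟩
    · exact Or.inl (h1 ▸ hxA)
    · exact Or.inr (h2 ▸ hxA)
  have heC : e ∉ G.edgesAt (G.cluster ω c) := by
    rintro (h | h) <;> rcases hend with ⟨h1, h2⟩ | ⟨h1, h2⟩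
    · exact hxC' (h1 ▸ h)
    · exact hyC (h1 ▸ h)
    · exact hyC (h2 ▸ h)
    · exact hxC' (h2 ▸ h)
  have h3 : e ∉ G.swapSetBC ω a b c := fun hmem => (G.mem_swapSetBC.mp hmem).2 heA
  have h1 : e ∉ G.swapSetC ω a b c := by
    intro hmem
    rcases G.mem_swapSetC.mp hmem with h | h
    · exact heC h
    · exact h.2 heA
  rw [mix_apply_of_notMem h3] at he
  rw [mix_apply_of_notMem h1]
  exact he

/-- Inside `B`, `ω →_{S₁} ω'` carries `ω`: the cluster of `b` is connected in it. -/
theorem conn_swapSetC_of_mem_cluster (hab : ¬ G.Conn ω a b) {y : V} (hy : y ∈ G.cluster ω b) :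
    G.Conn (mix (G.swapSetC ω a b c) ω ω') b y := by
  refine conn_of_open_edges (fun e he hmem => ?_) hy
  have hboth : G.fst e ∈ G.cluster ω b ∧ G.snd e ∈ G.cluster ω b := by
    rcases hmem with h | h
    · exact ⟨h, G.snd_mem_cluster_of_open he h⟩
    · exact ⟨G.fst_mem_cluster_of_open he h, h⟩
  have heA : e ∉ G.edgesAt (G.cluster ω a) := by
    rintro (h | h)
    · exact hab ((h : G.Conn ω a _).trans (hboth.1 : G.Conn ω b _).symm)
    · exact hab ((h : G.Conn ω a _).trans (hboth.2 : G.Conn ω b _).symm)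
  rw [mix_apply_of_mem (G.mem_swapSetC.mpr (Or.inr ⟨hmem, heA⟩))]
  exact he

/-- **Key observation** (GZ24, proof of Theorem 4.6): if `a` is separated from `b` and `c` in
`ω` and joined to `b` or `c` in `ω →_{S₃} ω'`, then `a ~ b` in `ω →_{S₁} ω'` or `a ~ c` in
`ω →_{S₂} ω'`. -/
theorem conn_swapSetC_of_conn_swapSetBC
    (hab : ¬ G.Conn ω a b) (hac : ¬ G.Conn ω a c) (hbc : ¬ G.Conn ω b c)
    (hU : G.Conn (mix (G.swapSetBC ω a b c) ω ω') a b ∨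
      G.Conn (mix (G.swapSetBC ω a b c) ω ω') a c) :
    G.Conn (mix (G.swapSetC ω a b c) ω ω') a b ∨ G.Conn (mix (G.swapSetC ω a c b) ω ω') a c := by
  have hcb : ¬ G.Conn ω c b := fun h => hbc h.symm
  have hΦ : mix (G.swapSetBC ω a c b) ω ω' = mix (G.swapSetBC ω a b c) ω ω' := by
    rw [G.swapSetBC_comm]
  have main : ∀ z, G.Conn (mix (G.swapSetBC ω a b c) ω ω') a z →
      (z ∉ G.cluster ω b ∧ z ∉ G.cluster ω c ∧
          G.Conn (mix (G.swapSetC ω a b c) ω ω') a z ∧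
          G.Conn (mix (G.swapSetC ω a c b) ω ω') a z) ∨
        G.Conn (mix (G.swapSetC ω a b c) ω ω') a b ∨
        G.Conn (mix (G.swapSetC ω a c b) ω ω') a c := by
    intro z hz
    refine Conn.induction (motive := fun z => (z ∉ G.cluster ω b ∧ z ∉ G.cluster ω c ∧
          G.Conn (mix (G.swapSetC ω a b c) ω ω') a z ∧
          G.Conn (mix (G.swapSetC ω a c b) ω ω') a z) ∨
        G.Conn (mix (G.swapSetC ω a b c) ω ω') a b ∨
        G.Conn (mix (G.swapSetC ω a c b) ω ω') a c)
      (Or.inl ⟨fun h => hab (h : G.Conn ω b a).symm, fun h => hac (h : G.Conn ω c a).symm,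
        Conn.refl _ _ _, Conn.refl _ _ _⟩) ?_ hz
    intro x y _ hxy hx
    rcases hx with ⟨hxB, hxC, h1, h2⟩ | h | h
    · obtain ⟨e, he, hend⟩ := hxy
      by_cases hyB : y ∈ G.cluster ω b
      · refine Or.inr (Or.inl ?_)
        have hay : G.Conn (mix (G.swapSetC ω a b c) ω ω') a y :=
          h1.tail ⟨e, swapSetC_open_of_into hab hbc hxB hxC hyB he hend, hend⟩
        exact hay.trans (conn_swapSetC_of_mem_cluster hab hyB).symm
      by_cases hyC : y ∈ G.cluster ω c
      · refine Or.inr (Or.inr ?_)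
        have he' : mix (G.swapSetBC ω a c b) ω ω' e = true := by rw [hΦ]; exact he
        have hay : G.Conn (mix (G.swapSetC ω a c b) ω ω') a y :=
          h2.tail ⟨e, swapSetC_open_of_into hac hcb hxC hxB hyC he' hend, hend⟩
        exact hay.trans (conn_swapSetC_of_mem_cluster hac hyC).symm
      · refine Or.inl ⟨hyB, hyC, ?_, ?_⟩
        · exact h1.tail ⟨e, swapSetC_open_of_outside hxB hxC hyB hyC he hend, hend⟩
        · have he' : mix (G.swapSetBC ω a c b) ω ω' e = true := by rw [hΦ]; exact he
          exact h2.tail ⟨e, swapSetC_open_of_outside hxC hxB hyC hyB he' hend, hend⟩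
    · exact Or.inr (Or.inl h)
    · exact Or.inr (Or.inr h)
  rcases hU with hb | hc
  · rcases main b hb with ⟨hbB, _⟩ | h | h
    · exact absurd (G.self_mem_cluster ω b) hbB
    · exact Or.inl h
    · exact Or.inr h
  · rcases main c hc with ⟨_, hcC, _⟩ | h | h
    · exact absurd (G.self_mem_cluster ω c) hcC
    · exact Or.inl h
    · exact Or.inr h

end KeyObservation

/-! ### The inequality -/

section Main

/-- `a ≁ b ∧ a ≁ c` is read off the first configuration swapped along `S₃` (its `a`-cluster is
that of `ω`). -/
theorem mem_sep_mix_compl_swapSetBC_iff (ω ω' : Config E) (a b c : V) :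
    mix (G.swapSetBC ω a b c)ᶜ ω ω' ∈ G.sepEvent a b ∩ G.sepEvent a c ↔
      ω ∈ G.sepEvent a b ∩ G.sepEvent a c := by
  have h := cluster_mix_compl_swapSetBC (G := G) ω ω' a b c
  simp only [Set.mem_inter_iff, mem_sepEvent, ← mem_cluster_iff_conn, h]

/-- The pointwise form of GZ24's argument: for every pair `(ω, ω')`,
`1[ω →_{S₃ᶜ} ω' ∈ a|b ∩ a|c] · 1[ω →_{S₃} ω' ∈ ab ∪ ac] ≤ 1[ω →_{S₁} ω' ∈ ab|c] + 1[ω →_{S₂} ω' ∈ ac|b] + 1[ω ∈ bc|a]`. -/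
theorem indicator_bound (ω ω' : Config E) (a b c : V) :
    (G.sepEvent a b ∩ G.sepEvent a c).indicator 1 (mix (G.swapSetBC ω a b c)ᶜ ω ω') *
        (G.connEvent a b ∪ G.connEvent a c).indicator 1 (mix (G.swapSetBC ω a b c) ω ω') ≤
      (G.connEvent a b ∩ G.sepEvent a c).indicator 1 (mix (G.swapSetC ω a b c) ω ω') +
        (G.connEvent a c ∩ G.sepEvent a b).indicator 1 (mix (G.swapSetC ω a c b) ω ω') +
        (G.connEvent b c ∩ G.sepEvent a b).indicator (1 : Config E → ℝ) ω := by
  have key : mix (G.swapSetBC ω a b c)ᶜ ω ω' ∈ G.sepEvent a b ∩ G.sepEvent a c →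
      mix (G.swapSetBC ω a b c) ω ω' ∈ G.connEvent a b ∪ G.connEvent a c →
      mix (G.swapSetC ω a b c) ω ω' ∈ G.connEvent a b ∩ G.sepEvent a c ∨
        mix (G.swapSetC ω a c b) ω ω' ∈ G.connEvent a c ∩ G.sepEvent a b ∨
        ω ∈ G.connEvent b c ∩ G.sepEvent a b := by
    intro hA hU
    obtain ⟨hab, hac⟩ := (mem_sep_mix_compl_swapSetBC_iff (G := G) ω ω' a b c).mp hA
    by_cases hbc : G.Conn ω b c
    · exact Or.inr (Or.inr ⟨hbc, hab⟩)
    rcases conn_swapSetC_of_conn_swapSetBC hab hac hbc hU with h | h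
    · refine Or.inl ⟨h, fun hc => hac ?_⟩
      have hcl := cluster_mix_swapSetC (G := G) ω ω' a b c
      have : a ∈ G.cluster (mix (G.swapSetC ω a b c) ω ω') c := (hc : G.Conn _ a c).symm
      rw [hcl] at this
      exact (this : G.Conn ω c a).symm
    · refine Or.inr (Or.inl ⟨h, fun hb => hab ?_⟩)
      have hcl := cluster_mix_swapSetC (G := G) ω ω' a c b
      have : a ∈ G.cluster (mix (G.swapSetC ω a c b) ω ω') b := (hb : G.Conn _ a b).symm
      rw [hcl] at this
      exact (this : G.Conn ω b a).symm
  unfold Set.indicator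
  simp only [Pi.one_apply]
  split_ifs <;> norm_num
  all_goals (rcases key ‹_› ‹_› with h | h | h <;> contradiction)

variable [Fintype E] [DecidableEq E]

/-- `∑_ω ∑_ω' w(ω) w(ω') 1_X(ω) = P(X)`. -/
theorem sum_sum_weight_mul_indicator_left (p : E → ℝ) (X : Set (Config E)) :
    ∑ ω, ∑ ω', weight p ω * weight p ω' * X.indicator 1 ω = prob p X := by
  have : ∀ ω : Config E, ∑ ω', weight p ω * weight p ω' * X.indicator 1 ω =
      X.indicator (weight p) ω := by
    intro ω
    rw [← Finset.sum_mul, ← Finset.mul_sum, sum_weight, mul_one]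
    by_cases h : ω ∈ X <;> simp [h]
  unfold prob
  exact Finset.sum_congr rfl fun ω _ => this ω

/-- **Gladkov–Zimin, eq. (final)** (arXiv:2404.08873, Theorem 4.6), event form, for any three
vertices of any finite multigraph and any edge weights:
`P(a≁b ∧ a≁c) · P(a~b ∨ a~c) ≤ P(ab|c) + P(ac|b) + P(bc|a)`. -/
theorem gz24_final_events (p : E → ℝ) (hp : IsProb p) (a b c : V) :
    prob p (G.sepEvent a b ∩ G.sepEvent a c) * prob p (G.connEvent a b ∪ G.connEvent a c) ≤
      prob p (G.connEvent a b ∩ G.sepEvent a c) + prob p (G.connEvent a c ∩ G.sepEvent a b) +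
        prob p (G.connEvent b c ∩ G.sepEvent a b) := by
  rw [prob_mul_prob_eq_sum_swap p (recoverable_swapSetBC (G := G) a b c)]
  calc ∑ ω, ∑ ω', weight p ω * weight p ω' *
        ((G.sepEvent a b ∩ G.sepEvent a c).indicator 1 (mix (G.swapSetBC ω a b c)ᶜ ω ω') *
          (G.connEvent a b ∪ G.connEvent a c).indicator 1 (mix (G.swapSetBC ω a b c) ω ω'))
      ≤ ∑ ω, ∑ ω', weight p ω * weight p ω' *
          ((G.connEvent a b ∩ G.sepEvent a c).indicator 1 (mix (G.swapSetC ω a b c) ω ω') +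
            (G.connEvent a c ∩ G.sepEvent a b).indicator 1 (mix (G.swapSetC ω a c b) ω ω') +
            (G.connEvent b c ∩ G.sepEvent a b).indicator (1 : Config E → ℝ) ω) := by
        refine Finset.sum_le_sum fun ω _ => Finset.sum_le_sum fun ω' _ => ?_
        exact mul_le_mul_of_nonneg_left (indicator_bound (G := G) ω ω' a b c)
          (mul_nonneg (weight_nonneg hp ω) (weight_nonneg hp ω'))
    _ = (∑ ω, ∑ ω', weight p ω * weight p ω' *
            (G.connEvent a b ∩ G.sepEvent a c).indicator 1 (mix (G.swapSetC ω a b c) ω ω')) +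
          (∑ ω, ∑ ω', weight p ω * weight p ω' *
            (G.connEvent a c ∩ G.sepEvent a b).indicator 1 (mix (G.swapSetC ω a c b) ω ω')) +
          ∑ ω, ∑ ω', weight p ω * weight p ω' *
            (G.connEvent b c ∩ G.sepEvent a b).indicator (1 : Config E → ℝ) ω := by
        simp only [mul_add, Finset.sum_add_distrib]
    _ = _ := by
        rw [sum_indicator_mix_eq_prob p (recoverable_swapSetC (G := G) a b c),
          sum_indicator_mix_eq_prob p (recoverable_swapSetC (G := G) a c b),
          sum_sum_weight_mul_indicator_left]

/-- **The constant-1 form of C-021** (p2's LIT line: the printed constant of GZ24 eq. (final)):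
`P(abc) · P(a|b|c) ≤ P(exactly one pair connected) = P(ab|c) + P(ac|b) + P(bc|a)`, by two
monotonicity steps from `gz24_final_events` (`a|b|c ⊆ {a≁b ∧ a≁c}`, `abc ⊆ {a~b ∨ a~c}`). -/
theorem c021_const_one (p : E → ℝ) (hp : IsProb p) (a b c : V) :
    prob p (G.connEvent a b ∩ G.connEvent b c) *
        prob p (G.sepEvent a b ∩ G.sepEvent a c ∩ G.sepEvent b c) ≤
      prob p (G.connEvent a b ∩ G.sepEvent a c) + prob p (G.connEvent a c ∩ G.sepEvent a b) +
        prob p (G.connEvent b c ∩ G.sepEvent a b) := by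
  have h := G.gz24_final_events p hp a b c
  have h1 : prob p (G.connEvent a b ∩ G.connEvent b c) ≤
      prob p (G.connEvent a b ∪ G.connEvent a c) :=
    prob_mono hp (Set.inter_subset_left.trans Set.subset_union_left)
  have h2 : prob p (G.sepEvent a b ∩ G.sepEvent a c ∩ G.sepEvent b c) ≤
      prob p (G.sepEvent a b ∩ G.sepEvent a c) :=
    prob_mono hp Set.inter_subset_left
  have h3 := prob_nonneg hp (G.connEvent a b ∩ G.connEvent b c)
  have h4 := prob_nonneg hp (G.sepEvent a b ∩ G.sepEvent a c)
  calc prob p (G.connEvent a b ∩ G.connEvent b c) *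
        prob p (G.sepEvent a b ∩ G.sepEvent a c ∩ G.sepEvent b c)
      ≤ prob p (G.sepEvent a b ∩ G.sepEvent a c) * prob p (G.connEvent a b ∪ G.connEvent a c) := by
        rw [mul_comm]
        exact mul_le_mul h2 h1 h3 h4
    _ ≤ _ := h

/-- The constant-1 form of C-021 in the engine's rows: `T · B ≤ P1 + P2 + P3`. -/
theorem c021_const_one_law3 (p : E → ℝ) (hp : IsProb p) (a b c : V) :
    G.law3 p a b c 0 * G.law3 p a b c 4 ≤
      G.law3 p a b c 1 + G.law3 p a b c 2 + G.law3 p a b c 3 := by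
  rw [MultiGraph.law3_zero, MultiGraph.law3_one, MultiGraph.law3_two, MultiGraph.law3_three,
    MultiGraph.law3_four, G.partitionEvent_row_abc, G.partitionEvent_row_ab_c,
    G.partitionEvent_row_ac_b, G.partitionEvent_row_bc_a, G.partitionEvent_row_a_b_c]
  exact G.c021_const_one p hp a b c

end Main

end MultiGraph

/-- `P(a≁b ∧ a≁c) = P(a|b|c) + P(bc|a)` in the engine's rows. -/
theorem law3_four_add_three {V E : Type*} [Fintype E] [DecidableEq E] (G : MultiGraph V E)
    (p : E → ℝ) (a b c : V) :
    G.law3 p a b c 4 + G.law3 p a b c 3 = prob p (G.sepEvent a b ∩ G.sepEvent a c) := by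
  rw [MultiGraph.law3_four, MultiGraph.law3_three, G.partitionEvent_row_a_b_c,
    G.partitionEvent_row_bc_a]
  have h := prob_inter_add_prob_inter_compl p (G.sepEvent a b ∩ G.sepEvent a c) (G.connEvent b c)
  have e1 : G.sepEvent a b ∩ G.sepEvent a c ∩ G.connEvent b c = G.connEvent b c ∩ G.sepEvent a b := by
    ext ω
    obtain ⟨h1, h2, h3⟩ := G.conn_three_trans a b c (ω := ω)
    simp only [Set.mem_inter_iff, MultiGraph.mem_connEvent, MultiGraph.mem_sepEvent]
    tauto
  have e2 : G.sepEvent a b ∩ G.sepEvent a c ∩ (G.connEvent b c)ᶜ =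
      G.sepEvent a b ∩ G.sepEvent a c ∩ G.sepEvent b c := rfl
  rw [e1, e2] at h
  linarith

/-- `P(a~b ∨ a~c) = P(abc) + P(ab|c) + P(ac|b)` in the engine's rows. -/
theorem law3_zero_add_one_add_two {V E : Type*} [Fintype E] [DecidableEq E] (G : MultiGraph V E)
    (p : E → ℝ) (a b c : V) :
    G.law3 p a b c 0 + G.law3 p a b c 1 + G.law3 p a b c 2 =
      prob p (G.connEvent a b ∪ G.connEvent a c) := by
  rw [MultiGraph.law3_zero, MultiGraph.law3_one, MultiGraph.law3_two, G.partitionEvent_row_abc,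
    G.partitionEvent_row_ab_c, G.partitionEvent_row_ac_b]
  have h := prob_inter_add_prob_inter_compl p (G.connEvent a b ∪ G.connEvent a c) (G.connEvent a b)
  have h' := prob_inter_add_prob_inter_compl p (G.connEvent a b) (G.connEvent b c)
  have e1 : (G.connEvent a b ∪ G.connEvent a c) ∩ G.connEvent a b = G.connEvent a b := by
    ext ω
    simp only [Set.mem_inter_iff, Set.mem_union, MultiGraph.mem_connEvent]
    tauto
  have e2 : (G.connEvent a b ∪ G.connEvent a c) ∩ (G.connEvent a b)ᶜ =
      G.connEvent a c ∩ G.sepEvent a b := by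
    ext ω
    simp only [Set.mem_inter_iff, Set.mem_union, Set.mem_compl_iff, MultiGraph.mem_connEvent,
      MultiGraph.mem_sepEvent]
    tauto
  have e3 : G.connEvent a b ∩ (G.connEvent b c)ᶜ = G.connEvent a b ∩ G.sepEvent a c := by
    ext ω
    obtain ⟨h1, h2, h3⟩ := G.conn_three_trans a b c (ω := ω)
    simp only [Set.mem_inter_iff, Set.mem_compl_iff, MultiGraph.mem_connEvent,
      MultiGraph.mem_sepEvent]
    tauto
  rw [e1, e2] at h
  rw [e3] at h'
  linarith

/-- **Gladkov–Zimin, eq. (final)** in the engine's rows `T, P1, P2, P3, B` of `law3`: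
`(B + P3)(T + P1 + P2) ≤ P1 + P2 + P3`. -/
theorem MultiGraph.gz24_final_law3 {V E : Type*} [Fintype E] [DecidableEq E] (G : MultiGraph V E)
    (p : E → ℝ) (hp : IsProb p) (a b c : V) :
    (G.law3 p a b c 4 + G.law3 p a b c 3) *
        (G.law3 p a b c 0 + G.law3 p a b c 1 + G.law3 p a b c 2) ≤
      G.law3 p a b c 1 + G.law3 p a b c 2 + G.law3 p a b c 3 := by
  rw [law3_four_add_three, law3_zero_add_one_add_two, MultiGraph.law3_one, MultiGraph.law3_two,
    MultiGraph.law3_three, G.partitionEvent_row_ab_c, G.partitionEvent_row_ac_b,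
    G.partitionEvent_row_bc_a]
  exact G.gz24_final_events p hp a b c

end PercRepro
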